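import Literature.Computability.AlgebraicComplexity.RectangularExponentAlpha
import HarnessLib

/-!
# The exponent `μ`: the solution of `ω(1, μ, 1) = 1 + 2μ`

Topic `Literature/Computability/AlgebraicComplexity`.  Alman–Duan–Vassilevska Williams–Xu–Xu–Zhou,
*More asymmetry yields faster matrix multiplication* (SODA 2025, arXiv:2404.16349), §1:

> As a specific example for a rectangular matrix multiplication exponent, we obtain a new bound for
> the exponent `μ` satisfying the equation `ω(1,μ,1) = 1+2μ`. The previous bound from [VXXZ24] was
> `μ < 0.527661` and we improve it to `μ < 0.5275`. The value `μ` is a key part of the best known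
> running times of several important problems, including All-Pairs Shortest Paths (APSP) in
> unweighted directed graphs [Zwick 2002] …

and §7: "In particular, we showed that `ω ≤ 2.371339` and `μ ≤ 0.527500`."  (The exponent is
Zwick's, *All pairs shortest paths using bridging sets and rectangular matrix multiplication*,
J. ACM 49 (2002): "let `μ` satisfy `ω(1, μ, 1) = 1 + 2μ`".)

## Contents (everything proved; one definition, no named facts)

For the tree's rank-form exponents `ω(1, κ, 1) = omegaRect K 1 κ 1` (`RectangularExponent.lean`):

* `muExponent K = μ := inf {κ ≥ 0 | ω(1, κ, 1) ≤ 1 + 2κ}` — the definition;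
* the equation really has a unique non-negative solution and `μ` is it: the defining set is an
  up-set of `[0, ∞)` (`ω(1,·,1)` is `1`-Lipschitz, `omegaRect_one_mid_one_le_add`), closed
  (continuity, `continuous_omegaRect_one_mid_one`) and contains `1` (`ω ≤ 3`), whence
  `omegaRect_muExponent : ω(1, μ, 1) = 1 + 2μ`, `muExponent_le_iff : μ ≤ κ ↔ ω(1,κ,1) ≤ 1 + 2κ`
  (`κ ≥ 0`), `muExponent_unique : ω(1,κ,1) = 1 + 2κ → κ = μ`;
* `half_le_muExponent : 1/2 ≤ μ` (`ω(1,κ,1) ≥ 2`), `muExponent_le_one`,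
  `muExponent_le : μ ≤ (ω − 1)/2` (monotonicity: `1 + 2μ = ω(1,μ,1) ≤ ω`; Zwick's remark that
  `μ < 0.575` follows from `ω < 2.376`), `muExponent_eq_half_of_omega_eq_two`;
* the printed records as consequences of the vendored tables (named facts of
  `RectangularExponent.lean`, NOT restated): `advxxz2025_omegaRect_table.mu_le : μ(ℂ) ≤ 0.5275`
  (row `(0.5275, 2.054999)` of ADVXXZ Table 1, `2.054999 ≤ 1 + 2 · 0.5275`) and
  `vxxz2024_omegaRect_table.mu_le : μ(ℂ) ≤ 0.527661` (row `(0.527661, 2.055322)` of VXXZ Table 1).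

## References

* J. Alman, R. Duan, V. Vassilevska Williams, Y. Xu, Z. Xu, R. Zhou, *More asymmetry yields faster
  matrix multiplication*, SODA 2025, arXiv:2404.16349 (held: `paper:arxiv-2404.16349`), §1 (chunk
  p0003: definition of `μ`, `μ < 0.5275`), §1 Table 1, §7. [AlmanDuanVassilevskaWilliamsXuXuZhou2025]
* V. Vassilevska Williams, Y. Xu, Z. Xu, R. Zhou, *New bounds for matrix multiplication: from alpha
  to omega*, SODA 2024, arXiv:2307.07970, §1.1 Table 1 (`μ ≤ 0.527661`).
  [VassilevskaWilliamsXuXuZhou2024]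
* U. Zwick, *All pairs shortest paths using bridging sets and rectangular matrix multiplication*,
  J. ACM 49 (2002) 289–317 (the exponent `μ`, APSP in `Õ(n^{2+μ})`).
-/

noncomputable section

namespace Literature.Computability.AlgebraicComplexity

variable (K : Type) [Field K]

/-- **The exponent `μ` of rectangular matrix multiplication**: the (unique, see
`omegaRect_muExponent`, `muExponent_unique`) solution `μ ≥ 0` of `ω(1, μ, 1) = 1 + 2μ`, realised as
`inf {κ ≥ 0 | ω(1, κ, 1) ≤ 1 + 2κ}` (a conditionally complete infimum over `ℝ`; the set is non-empty
and bounded below, `muSet_nonempty`, `muSet_bddBelow`).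
[cite: AlmanDuanVassilevskaWilliamsXuXuZhou2025, §1] -/
def muExponent : ℝ :=
  sInf {κ : ℝ | 0 ≤ κ ∧ omegaRect K 1 κ 1 ≤ 1 + 2 * κ}

/-- Unfolding `μ`. [folklore] -/
theorem muExponent_def :
    muExponent K = sInf {κ : ℝ | 0 ≤ κ ∧ omegaRect K 1 κ 1 ≤ 1 + 2 * κ} := rfl

/-- `κ = 1` solves the inequality: `ω(1,1,1) = ω ≤ 3`. [folklore] -/
theorem one_mem_muSet : (1 : ℝ) ∈ {κ : ℝ | 0 ≤ κ ∧ omegaRect K 1 κ 1 ≤ 1 + 2 * κ} := by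
  refine ⟨zero_le_one, ?_⟩
  rw [omegaRect_one_one_one]
  have := omega_le_three' K
  linarith

/-- The defining set of `μ` is non-empty. [folklore] -/
theorem muSet_nonempty : {κ : ℝ | 0 ≤ κ ∧ omegaRect K 1 κ 1 ≤ 1 + 2 * κ}.Nonempty :=
  ⟨1, one_mem_muSet K⟩

/-- The defining set of `μ` is bounded below (by `0`). [folklore] -/
theorem muSet_bddBelow : BddBelow {κ : ℝ | 0 ≤ κ ∧ omegaRect K 1 κ 1 ≤ 1 + 2 * κ} :=
  ⟨0, fun _ h => h.1⟩

/-- The defining set of `μ` is an up-set of `[0, ∞)`: if `ω(1,κ₀,1) ≤ 1 + 2κ₀` and `κ₀ ≤ κ` then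
`ω(1,κ,1) ≤ ω(1,κ₀,1) + (κ − κ₀) ≤ 1 + 2κ` (`ω(1,·,1)` grows with slope at most `1`).
[cite: AlmanDuanVassilevskaWilliamsXuXuZhou2025, §1] -/
theorem mem_muSet_of_le {κ₀ κ : ℝ}
    (h₀ : κ₀ ∈ {κ : ℝ | 0 ≤ κ ∧ omegaRect K 1 κ 1 ≤ 1 + 2 * κ}) (hle : κ₀ ≤ κ) :
    κ ∈ {κ : ℝ | 0 ≤ κ ∧ omegaRect K 1 κ 1 ≤ 1 + 2 * κ} := by
  refine ⟨h₀.1.trans hle, ?_⟩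
  have h := omegaRect_one_mid_one_le_add K hle
  have h' := h₀.2
  linarith

/-- `0 ≤ μ`. [folklore] -/
theorem muExponent_nonneg : 0 ≤ muExponent K :=
  le_csInf (muSet_nonempty K) fun _ h => h.1

/-- `μ ≤ 1` (`ω ≤ 3`). [folklore] -/
theorem muExponent_le_one : muExponent K ≤ 1 :=
  csInf_le (muSet_bddBelow K) (one_mem_muSet K)

/-- `μ` belongs to its defining set: **`ω(1, μ, 1) ≤ 1 + 2μ`** (the set is closed, by continuity of
`κ ↦ ω(1,κ,1)`). [cite: AlmanDuanVassilevskaWilliamsXuXuZhou2025, §1] -/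
theorem omegaRect_muExponent_le : omegaRect K 1 (muExponent K) 1 ≤ 1 + 2 * muExponent K := by
  have hclosed : IsClosed {κ : ℝ | 0 ≤ κ ∧ omegaRect K 1 κ 1 ≤ 1 + 2 * κ} := by
    have h1 : IsClosed {κ : ℝ | 0 ≤ κ} := isClosed_le continuous_const continuous_id
    have h2 : IsClosed {κ : ℝ | omegaRect K 1 κ 1 ≤ 1 + 2 * κ} :=
      isClosed_le (continuous_omegaRect_one_mid_one K) (by fun_prop)
    exact h1.inter h2
  exact ((hclosed.csInf_mem (muSet_nonempty K) (muSet_bddBelow K)).2)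

/-- **Characterisation**: for `κ ≥ 0`, `μ ≤ κ ↔ ω(1, κ, 1) ≤ 1 + 2κ`.
[cite: AlmanDuanVassilevskaWilliamsXuXuZhou2025, §1] -/
theorem muExponent_le_iff {κ : ℝ} (hκ : 0 ≤ κ) :
    muExponent K ≤ κ ↔ omegaRect K 1 κ 1 ≤ 1 + 2 * κ := by
  constructor
  · intro h
    exact (mem_muSet_of_le K ⟨muExponent_nonneg K, omegaRect_muExponent_le K⟩ h).2
  · intro h
    exact csInf_le (muSet_bddBelow K) ⟨hκ, h⟩

/-- Below `μ` the inequality fails: `0 ≤ κ < μ → 1 + 2κ < ω(1, κ, 1)`. [cite: AlmanDuanVassilevskaWilliamsXuXuZhou2025, §1] -/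
theorem lt_omegaRect_of_lt_muExponent {κ : ℝ} (hκ : 0 ≤ κ) (h : κ < muExponent K) :
    1 + 2 * κ < omegaRect K 1 κ 1 := by
  by_contra h'
  exact absurd ((muExponent_le_iff K hκ).2 (not_lt.1 h')) (not_le.2 h)

/-- **`μ` solves the equation: `ω(1, μ, 1) = 1 + 2μ`.** [cite: AlmanDuanVassilevskaWilliamsXuXuZhou2025, §1] -/
theorem omegaRect_muExponent : omegaRect K 1 (muExponent K) 1 = 1 + 2 * muExponent K := by
  refine le_antisymm (omegaRect_muExponent_le K) ?_
  by_contra hlt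
  rw [not_le] at hlt
  -- `ω(1, μ, 1) < 1 + 2μ`: then `μ > 0` (as `ω(1,0,1) = 2 > 1`) and, by continuity, the strict
  -- inequality persists at some `κ < μ`, contradicting the infimum
  set μ := muExponent K with hμ
  have hμ0 : 0 ≤ μ := muExponent_nonneg K
  have hμpos : 0 < μ := by
    rcases hμ0.lt_or_eq with h | h
    · exact h
    · exfalso
      rw [← h, omegaRect_one_zero_one] at hlt
      norm_num at hlt
  -- the gap `ε = 1 + 2μ − ω(1,μ,1) > 0`; take `κ = μ − δ` with `δ = min μ (ε/2)` hmm: use Lipschitz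
  set ε := 1 + 2 * μ - omegaRect K 1 μ 1 with hε
  have hεpos : 0 < ε := by rw [hε]; linarith
  set δ := min μ (ε / 4) with hδ
  have hδpos : 0 < δ := lt_min hμpos (by linarith)
  have hδμ : δ ≤ μ := min_le_left _ _
  have hδε : δ ≤ ε / 4 := min_le_right _ _
  have hκ0 : 0 ≤ μ - δ := by linarith
  have hκlt : μ - δ < μ := by linarith
  -- `ω(1, μ−δ, 1) ≤ ω(1, μ, 1)` (monotone) `< 1 + 2(μ − δ)`
  have hmono : omegaRect K 1 (μ - δ) 1 ≤ omegaRect K 1 μ 1 :=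
    omegaRect_one_mid_one_mono K hκlt.le
  have := lt_omegaRect_of_lt_muExponent K hκ0 hκlt
  linarith

/-- **Uniqueness**: a non-negative solution of `ω(1, κ, 1) = 1 + 2κ` is `μ` (`ω(1,·,1) − 2·` is
strictly decreasing, having slope at most `1 − 2 < 0`). [cite: AlmanDuanVassilevskaWilliamsXuXuZhou2025, §1] -/
theorem muExponent_unique {κ : ℝ} (hκ : 0 ≤ κ) (h : omegaRect K 1 κ 1 = 1 + 2 * κ) :
    κ = muExponent K := by
  have hle : muExponent K ≤ κ := (muExponent_le_iff K hκ).2 h.le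
  rcases hle.lt_or_eq with hlt | heq
  · exfalso
    have h1 := omegaRect_one_mid_one_le_add K hlt.le
    have h2 := omegaRect_muExponent K
    linarith
  · exact heq.symm

/-- **`μ ≥ 1/2`**: `1 + 2μ = ω(1, μ, 1) ≥ 2`. [folklore] -/
theorem half_le_muExponent : 1 / 2 ≤ muExponent K := by
  have h1 := omegaRect_muExponent K
  have h2 := two_le_omegaRect_one_mid_one K (muExponent K)
  linarith

/-- **`μ ≤ (ω − 1)/2`**, i.e. `1 + 2μ ≤ ω`: `1 + 2μ = ω(1, μ, 1) ≤ ω(1, 1, 1) = ω` (`μ ≤ 1`,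
monotonicity). [folklore] -/
theorem muExponent_le : muExponent K ≤ (omega K - 1) / 2 := by
  have h1 := omegaRect_muExponent K
  have h2 : omegaRect K 1 (muExponent K) 1 ≤ omegaRect K 1 1 1 :=
    omegaRect_one_mid_one_mono K (muExponent_le_one K)
  rw [omegaRect_one_one_one] at h2
  linarith

/-- If `ω = 2` then `μ = 1/2`. [folklore] -/
theorem muExponent_eq_half_of_omega_eq_two (h : omega K = 2) : muExponent K = 1 / 2 := by
  refine le_antisymm ?_ (half_le_muExponent K)
  have := muExponent_le K
  rw [h] at this
  linarith

/-- `ω(1, κ, 1) ≤ b` with `b ≤ 1 + 2κ`, `κ ≥ 0`, gives `μ ≤ κ` (how a table row bounds `μ`). [cite: AlmanDuanVassilevskaWilliamsXuXuZhou2025, §1 Table 1] -/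
theorem muExponent_le_of_omegaRect_le {κ b : ℝ} (hκ : 0 ≤ κ) (h : omegaRect K 1 κ 1 ≤ b)
    (hb : b ≤ 1 + 2 * κ) : muExponent K ≤ κ :=
  (muExponent_le_iff K hκ).2 (h.trans hb)

/-- **ADVXXZ 2025: `μ ≤ 0.5275`** (§1: "we improve it to `μ < 0.5275`"; §7: "`μ ≤ 0.527500`") — from
row `(0.5275, 2.054999)` of Table 1 (`advxxz2025_omegaRect_table`), as `2.054999 ≤ 1 + 2 · 0.5275`.
[cite: AlmanDuanVassilevskaWilliamsXuXuZhou2025, §1 Table 1 and §7] -/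
theorem advxxz2025_omegaRect_table.mu_le (h : advxxz2025_omegaRect_table) :
    muExponent ℂ ≤ 0.5275 := by
  have h1 := h 0.527500 2.054999 (by norm_num [advxxz2025Table])
  have h2 : (0.527500 : ℝ) = 0.5275 := by norm_num
  rw [h2] at h1
  exact muExponent_le_of_omegaRect_le ℂ (by norm_num) h1 (by norm_num)

/-- **VXXZ 2024: `μ ≤ 0.527661`** — from row `(0.527661, 2.055322)` of Table 1
(`vxxz2024_omegaRect_table`), `2.055322 = 1 + 2 · 0.527661`.
[cite: VassilevskaWilliamsXuXuZhou2024, §1.1 Table 1] -/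
theorem vxxz2024_omegaRect_table.mu_le (h : vxxz2024_omegaRect_table) :
    muExponent ℂ ≤ 0.527661 :=
  muExponent_le_of_omegaRect_le ℂ (by norm_num)
    (h 0.527661 2.055322 (by norm_num [vxxz2024Table])) (by norm_num)

/-- The 2025 bound on `μ` improves the 2024 one. [folklore] -/
theorem advxxz2025_omegaRect_table.mu_le_vxxz2024 (h : advxxz2025_omegaRect_table) :
    muExponent ℂ ≤ 0.527661 :=
  h.mu_le.trans (by norm_num)

end Literature.Computability.AlgebraicComplexity

end
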